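import Literature.NumberTheory.LFunctions.YoshidaWindowGramColumnData
import HarnessLib

/-!
# C∞ rung `R1E` (even sector) — DATA `M2L2T` part 1/1

Route context: Fourier–Galerkin / Schur-complement certificates of Weil positivity on a window ("format C", C∞ door `weilPositivityOn_of_cinf_pipeline`); supporting stmt-RiemannHypothesis-0098; seat rh-explicit-weil-2 (`cinfemit.py`/`emit_lean2.py`, HOME/rh-explicit-weil-2/gen17/EMITTER-PHASE2.md). Data / bookkeeping only; standard axioms; no RH claim.
-/

set_option autoImplicit false
-- `Summit.RiemannHypothesis.RiemannHypothesis.…` is the layout-mandated namespace (summit = problem name).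
set_option linter.dupNamespace false

namespace Summit.RiemannHypothesis.RiemannHypothesis.Theorems.WeilFormatC

open Literature.NumberTheory.LFunctions

namespace CinfR1E

/-- Packed rows part 1/1 of table `M2L2T` (word width 69, 4 words). -/
def M2L2T_P : List ℕ := [
  0x80c2c9388107ecf293fe3f6d68bf690d0f1fdc2eb531abe686ecc17c541f9efed3314,
  0x7bc25746cb1cf41a13f9c1e88eabb094fe192907569eb150e1bcfec9b269c4a3589ac,
  0x7dfe05d927d5186b62fdd07ca21ac1a8989fd00430dd9659ec00ff3c67239849834b2,
  0x629315b803d7c78013eee1fc5e97a7b15c9ef63c9a3fb71e993d0035ccc5503729764]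

end CinfR1E

end Summit.RiemannHypothesis.RiemannHypothesis.Theorems.WeilFormatC
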